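import Mathlib.LinearAlgebra.Dual.BaseChange
import Mathlib.LinearAlgebra.TensorProduct.Basis
import Mathlib.LinearAlgebra.TensorProduct.Tower
import Mathlib.LinearAlgebra.Matrix.ToLin
import Mathlib.Algebra.Field.Subfield.Basic
import Literature.AlgebraicGeometry.Motives.Varieties
import Literature.AlgebraicGeometry.Motives.PreWeilCohomology
import Literature.AlgebraicGeometry.Motives.WeilCohomology
import HarnessLib

-- provenance: harness21/H21/H21/Prelude/MotiveAbstract/Comparison.lean @ a90de71 (interim HEAD d8f2665); M5 mechanical rewrite
/-!
# Comparison of Weil cohomology theories and periods (trunk MotiveAbstract, prelude C14)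

Two Weil cohomology theories `H₁` (coefficients `K₁`) and `H₂` (coefficients `K₂`) on smooth
projective `k`-varieties are *compared* over a common overfield `L ⊇ K₁, K₂` by functorial
`L`-linear isomorphisms `L ⊗_{K₁} H₁ⁱ(X) ≅ L ⊗_{K₂} H₂ⁱ(X)` compatible with cup products, units,
traces and cycle classes. The two motivating examples are

* Artin's comparison `Hⁱ(X(ℂ), ℚ) ⊗ ℚ_ℓ ≅ Hⁱ_ét(X, ℚ_ℓ)` for `k ⊆ ℂ` (Artin, SGA 4 XI 4.4;
  Deligne–Milne, *Tannakian categories*, LNM 900 (1982), I §1, "Betti–étale comparison");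
* the de Rham–Betti comparison `Hⁱ_dR(X/k) ⊗_k ℂ ≅ Hⁱ(X(ℂ), ℚ) ⊗_ℚ ℂ` (Grothendieck 1966), whose
  matrix coefficients are the **periods** of `X` (Huber–Müller-Stach, *Periods and Nori motives*
  (2017), Ch. 11; Deligne–Milne I §1).

This file provides the *vocabulary*: a hypothesis structure `Literature.WeilComparison W₁ W₂ L`
(notion `betti_etale_comparison`) and, for a general `L`-linear map
`ι : L ⊗[K₁] V₁ →ₗ[L] L ⊗[K₂] V₂`, its set of periods, period matrix and period field
(notion `periods_of_variety`, **partially**: periods of a single `X`; the periods of a pair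
`(X, D)` needed by `periods.S03/S34` require relative de Rham / Betti cohomology, not built here).

## Main definitions

* `Literature.baseChangeBilin L f` : the `L`-bilinear extension of a `K`-bilinear map (auxiliary;
  Mathlib's `LinearMap.BilinMap.baseChange` only covers maps `M → M → N` with equal sources).
* `Literature.periodSet ι`, `Literature.periodField ι`, `Literature.periodMatrix ι b₁ b₂` : the periods
  `φ_L (ι (1 ⊗ v))` (`v ∈ V₁`, `φ ∈ V₂^∨`), the subfield of `L` they generate, and the matrix of
  `ι` in bases `b₁`, `b₂` (Huber–Müller-Stach Def. 11.1.1, §11.2).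
* `Literature.WeilComparison W₁ W₂ L` : comparison data between two pre-Weil cohomology theories;
  `C.isoEquiv hX i`, `C.symm`, `C.periodField X`.
* `Literature.AlgebraicGeometry.Motives.WeilComparison.isHomologicallyTrivial_iff` : homological
  triviality of a cycle is invariant under comparison (named fact; discharged in
  `Literature.AlgebraicGeometry.Motives.ComparisonProofs`).
* NOT here: the comparison invariance of the standard conjecture `D(X)` / `D`. Its statement
  mentions the OPEN standard conjectures of `Literature.AlgebraicGeometry.Motives.Correspondences`,
  which this vocabulary file deliberately does not import, so that the period vocabulary built
  on it (`PeriodComparison`, `RelativePeriods`, the Kontsevich–Zagier files under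
  `Literature.NumberTheory.Transcendental`) has an import cone free of open conjectures. It is
  stated and proved one level up, in
  `Literature.AlgebraicGeometry.Motives.ComparisonStandardConjectureDProofs`
  (`WeilComparison.standardConjectureD_iff_holds`,
  `WeilComparison.homNumStandardConjecture_iff_of_comparison`).

## Design choices

* As everywhere in the trunk, the data (`iso`, `isoInv`) is given on all `k`-schemes but the
  axioms (mutual inverses, naturality, multiplicativity, traces, cycle classes) are only imposed
  on smooth projective `X` (`∀ ⦃n X⦄, IsSmoothProjective n X → …`). Consequently `iso X i` is an
  `L`-linear *map*, upgraded to `C.isoEquiv hX i : _ ≃ₗ[L] _` on smooth projective `X`; both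
  directions are carried as data so that `C.symm` is a definition without choice.
* The period vocabulary is stated for an arbitrary `L`-linear map `ι` (not only an equivalence),
  so that `C.periodField X` needs no smoothness hypothesis.
* `periodField ι := Subfield.closure (periodSet ι)`. When `ι` is injective and `V₁ ≠ 0` this
  subfield contains the images of `K₁` and `K₂` (periods are stable under both scalar actions),
  whence the comparison with the closure of the period-matrix entries
  (`periodField_eq_closure_range_periodMatrix`).
* Mathlib: searched `period`, `Comparison`, `baseChange₂`, `BilinMap.baseChange`; Mathlib has no
  period matrices/fields of comparison isomorphisms. We use `Module.Dual.baseChange`,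
  `Module.Basis.baseChange`, `LinearMap.toMatrix`, `LinearMap.baseChange`,
  `TensorProduct.AlgebraTensorModule.distribBaseChange`, `Subfield.closure`.
* Grothendieck's period conjecture itself needs the motivic Galois group and is not stated.

## References

* P. Deligne, J. Milne, *Tannakian categories*, in LNM 900 (1982), I §1.
* M. Artin, SGA 4, Exposé XI, Théorème 4.4.
* A. Huber, S. Müller-Stach, *Periods and Nori motives*, Springer (2017), Ch. 11.
* S. Kleiman, *Algebraic cycles and the Weil conjectures* (1968), §3 (conjecture `D`; its comparison
  invariance is in `ComparisonStandardConjectureDProofs`).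
-/

universe u v w w'

open CategoryTheory AlgebraicGeometry MonoidalCategory CartesianMonoidalCategory Opposite
open scoped TensorProduct

noncomputable section

namespace Literature.AlgebraicGeometry.Motives

/-! ## Base change of bilinear maps -/

section BaseChangeBilin

variable {K : Type*} [CommRing K] (L : Type*) [CommRing L] [Algebra K L]
  {M N P : Type*} [AddCommGroup M] [Module K M] [AddCommGroup N] [Module K N]
  [AddCommGroup P] [Module K P]

/-- The `L`-bilinear extension `(L ⊗ M) × (L ⊗ N) → L ⊗ P` of a `K`-bilinear map `M × N → P`,
`(a ⊗ m, b ⊗ n) ↦ ab ⊗ f m n` (extension of scalars; Bourbaki, *Algèbre* II §5.1). Auxiliary: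
Mathlib's `LinearMap.BilinMap.baseChange` requires `M = N`. [folklore] -/
def baseChangeBilin (f : M →ₗ[K] N →ₗ[K] P) : L ⊗[K] M →ₗ[L] L ⊗[K] N →ₗ[L] L ⊗[K] P :=
  TensorProduct.curry
    (((TensorProduct.lift f).baseChange L) ∘ₗ
      (TensorProduct.AlgebraTensorModule.distribBaseChange K L M N).symm.toLinearMap)

/-- `baseChangeBilin L f (a ⊗ m) (b ⊗ n) = (a * b) ⊗ f m n`. [folklore] -/
@[simp]
lemma baseChangeBilin_tmul (f : M →ₗ[K] N →ₗ[K] P) (a b : L) (m : M) (n : N) :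
    baseChangeBilin L f (a ⊗ₜ m) (b ⊗ₜ n) = (a * b) ⊗ₜ f m n := by
  simp [baseChangeBilin]

end BaseChangeBilin

/-! ## Periods of a linear map between base-changed vector spaces -/

section Periods

variable {K₁ : Type*} {K₂ : Type*} {L : Type*} [Field K₁] [Field K₂] [Field L]
  [Algebra K₁ L] [Algebra K₂ L]
  {V₁ : Type*} [AddCommGroup V₁] [Module K₁ V₁] {V₂ : Type*} [AddCommGroup V₂] [Module K₂ V₂]

/-- The **set of periods** of an `L`-linear map `ι : L ⊗_{K₁} V₁ → L ⊗_{K₂} V₂` between the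
base changes of a `K₁`-space `V₁` and a `K₂`-space `V₂`: the numbers `φ_L (ι (1 ⊗ v)) ∈ L` for
`v ∈ V₁` and `φ ∈ V₂^∨` (`φ_L` the `L`-linear extension of `φ`). For the de Rham–Betti
comparison these are the periods `∫_γ ω` (Huber–Müller-Stach 2017, Def. 11.1.1; Deligne–Milne
1982, I §1). [cite: HuberMullerStach2017, Def. 11.1.1] -/
def periodSet (ι : L ⊗[K₁] V₁ →ₗ[L] L ⊗[K₂] V₂) : Set L :=
  {x | ∃ (v : V₁) (φ : Module.Dual K₂ V₂), x = Module.Dual.baseChange L φ (ι (1 ⊗ₜ v))}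

/-- The **period field** of `ι`: the subfield of `L` generated by its periods
(Huber–Müller-Stach 2017, §11.2 / §13.1, the field `ℚ(periods)`). [cite: HuberMullerStach2017, §11.2 / §13.1] -/
def periodField (ι : L ⊗[K₁] V₁ →ₗ[L] L ⊗[K₂] V₂) : Subfield L :=
  Subfield.closure (periodSet ι)

/-- `0` is a period (take `v = 0`). [folklore] -/
lemma zero_mem_periodSet (ι : L ⊗[K₁] V₁ →ₗ[L] L ⊗[K₂] V₂) : (0 : L) ∈ periodSet ι :=
  ⟨0, 0, by simp⟩

/-- Periods generate the period field. [folklore] -/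
lemma periodSet_subset_periodField (ι : L ⊗[K₁] V₁ →ₗ[L] L ⊗[K₂] V₂) :
    periodSet ι ⊆ periodField ι :=
  Subfield.subset_closure

variable {ι₁ ι₂ : Type*} [Fintype ι₁] [Fintype ι₂] [DecidableEq ι₁]

/-- The **period matrix** of `ι` with respect to a `K₁`-basis `b₁` of `V₁` and a `K₂`-basis `b₂`
of `V₂`: the matrix of `ι` in the base-changed `L`-bases `1 ⊗ b₁`, `1 ⊗ b₂`
(Huber–Müller-Stach 2017, §11.2, "period matrix"; Deligne–Milne 1982, I §1). [cite: HuberMullerStach2017, §11.2  "period matrix"] -/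
def periodMatrix (ι : L ⊗[K₁] V₁ →ₗ[L] L ⊗[K₂] V₂) (b₁ : Module.Basis ι₁ K₁ V₁)
    (b₂ : Module.Basis ι₂ K₂ V₂) : Matrix ι₂ ι₁ L :=
  LinearMap.toMatrix (b₁.baseChange L) (b₂.baseChange L) ι

/-- The `(i, j)` entry of the period matrix is the `i`-th coordinate of `ι (1 ⊗ b₁ j)`. [folklore] -/
lemma periodMatrix_apply (ι : L ⊗[K₁] V₁ →ₗ[L] L ⊗[K₂] V₂) (b₁ : Module.Basis ι₁ K₁ V₁)
    (b₂ : Module.Basis ι₂ K₂ V₂) (i : ι₂) (j : ι₁) :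
    periodMatrix ι b₁ b₂ i j = (b₂.baseChange L).repr (ι (1 ⊗ₜ b₁ j)) i := by
  simp [periodMatrix, LinearMap.toMatrix_apply]

/-- The entries of the period matrix are periods (`v = b₁ j`, `φ = b₂^∨ i`). [folklore] -/
lemma periodMatrix_mem_periodSet (ι : L ⊗[K₁] V₁ →ₗ[L] L ⊗[K₂] V₂)
    (b₁ : Module.Basis ι₁ K₁ V₁) (b₂ : Module.Basis ι₂ K₂ V₂) (i : ι₂) (j : ι₁) :
    periodMatrix ι b₁ b₂ i j ∈ periodSet ι := by
  refine ⟨b₁ j, b₂.coord i, ?_⟩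
  rw [periodMatrix_apply]
  induction ι (1 ⊗ₜ[K₁] b₁ j) using TensorProduct.induction_on with
  | zero => simp
  | tmul x y => simp
  | add x y hx hy => simp [hx, hy]

/-- For finite-dimensional `V₁ ≠ 0`, `V₂` and injective `ι`, the period field is generated by
the images of `K₁`, `K₂` and the entries of any period matrix (Huber–Müller-Stach 2017, §11.2:
the periods of `X` are the `K`-linear combinations of the entries of a period matrix). [cite: HuberMullerStach2017, §11.2] -/
def periodField_eq_closure_range_periodMatrix : Prop :=
  ∀ [Nonempty ι₁] (ι : L ⊗[K₁] V₁ →ₗ[L] L ⊗[K₂] V₂), Function.Injective ι →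
    ∀ (b₁ : Module.Basis ι₁ K₁ V₁) (b₂ : Module.Basis ι₂ K₂ V₂), periodField ι =
      Subfield.closure (Set.range (algebraMap K₁ L) ∪ Set.range (algebraMap K₂ L) ∪
        Set.range fun p : ι₂ × ι₁ ↦ periodMatrix ι b₁ b₂ p.1 p.2)

end Periods

/-! ## Comparison data between two Weil cohomology theories -/

namespace PreWeilCohomology

variable {k : Type u} [Field k] {K : Type v} [Field K] (W : PreWeilCohomology k K)
  (L : Type w') [Field L] [Algebra K L]

/-- The cup product extended `L`-bilinearly to `L ⊗_K Hⁱ(X) × L ⊗_K Hʲ(X) → L ⊗_K Hⁿ(X)`,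
`(a ⊗ x, b ⊗ y) ↦ ab ⊗ (x ∪ y)` (Deligne–Milne 1982, I §1: comparison isomorphisms are
isomorphisms of graded algebras after extension of scalars). [cite: DeligneMilne1982, I §1: comparison isomorphisms are isomor] -/
def cupBaseChange {X : SchemeOver k} {i j n : ℕ} (h : i + j = n) :
    L ⊗[K] W.obj X i →ₗ[L] L ⊗[K] W.obj X j →ₗ[L] L ⊗[K] W.obj X n :=
  baseChangeBilin L (W.cup h)

/-- `cupBaseChange` on pure tensors. [folklore] -/
@[simp]
lemma cupBaseChange_tmul {X : SchemeOver k} {i j n : ℕ} (h : i + j = n) (a b : L)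
    (x : W.obj X i) (y : W.obj X j) :
    W.cupBaseChange L h (a ⊗ₜ x) (b ⊗ₜ y) = (a * b) ⊗ₜ W.cup h x y :=
  baseChangeBilin_tmul L (W.cup h) a b x y

end PreWeilCohomology

/-- **Comparison data** between two pre-Weil cohomology theories `W₁` (coefficients `K₁`) and
`W₂` (coefficients `K₂`) over a common field `L ⊇ K₁, K₂`: `L`-linear maps
`iso X i : L ⊗_{K₁} H₁ⁱ(X) → L ⊗_{K₂} H₂ⁱ(X)` and `isoInv X i` in the other direction which, for
`X` smooth projective, are mutually inverse, natural for pull-backs, multiplicative, unital,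
compatible with traces and with cycle classes. This is the hypothesis structure standing in for
Artin's comparison theorem `H_B ⊗ ℚ_ℓ ≅ H_ét` (SGA 4 XI 4.4; Deligne–Milne 1982, I §1) and for
the de Rham–Betti comparison (Grothendieck 1966; Huber–Müller-Stach 2017, Ch. 11). [cite: DeligneMilne1982, I §1] -/
structure WeilComparison {k : Type u} [Field k] {K₁ : Type v} {K₂ : Type w} [Field K₁]
    [Field K₂] (W₁ : PreWeilCohomology k K₁) (W₂ : PreWeilCohomology k K₂) (L : Type w')
    [Field L] [Algebra K₁ L] [Algebra K₂ L] where
  /-- The comparison map `L ⊗_{K₁} H₁ⁱ(X) →ₗ[L] L ⊗_{K₂} H₂ⁱ(X)`. -/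
  iso (X : SchemeOver k) (i : ℕ) : L ⊗[K₁] W₁.obj X i →ₗ[L] L ⊗[K₂] W₂.obj X i
  /-- The inverse comparison map `L ⊗_{K₂} H₂ⁱ(X) →ₗ[L] L ⊗_{K₁} H₁ⁱ(X)`. -/
  isoInv (X : SchemeOver k) (i : ℕ) : L ⊗[K₂] W₂.obj X i →ₗ[L] L ⊗[K₁] W₁.obj X i
  /-- `isoInv ∘ iso = id` on smooth projective `X`. -/
  isoInv_iso : ∀ ⦃n : ℕ⦄ ⦃X : SchemeOver k⦄, IsSmoothProjective n X →
    ∀ (i : ℕ) (x : L ⊗[K₁] W₁.obj X i), isoInv X i (iso X i x) = x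
  /-- `iso ∘ isoInv = id` on smooth projective `X`. -/
  iso_isoInv : ∀ ⦃n : ℕ⦄ ⦃X : SchemeOver k⦄, IsSmoothProjective n X →
    ∀ (i : ℕ) (y : L ⊗[K₂] W₂.obj X i), iso X i (isoInv X i y) = y
  /-- Naturality: `iso_X ∘ (f*)_L = (f*)_L ∘ iso_Y` for `f : X ⟶ Y` between smooth projective
  varieties (Deligne–Milne 1982, I §1). -/
  iso_pullback : ∀ ⦃n : ℕ⦄ ⦃X : SchemeOver k⦄, IsSmoothProjective n X →
    ∀ ⦃m : ℕ⦄ ⦃Y : SchemeOver k⦄, IsSmoothProjective m Y → ∀ (f : X ⟶ Y) (i : ℕ)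
      (x : L ⊗[K₁] W₁.obj Y i),
      iso X i ((W₁.pullback f i).baseChange L x) = (W₂.pullback f i).baseChange L (iso Y i x)
  /-- The comparison preserves units: `iso (1 ⊗ 1) = 1 ⊗ 1`. -/
  iso_one : ∀ ⦃n : ℕ⦄ ⦃X : SchemeOver k⦄, IsSmoothProjective n X →
    iso X 0 (1 ⊗ₜ W₁.one X) = 1 ⊗ₜ W₂.one X
  /-- The comparison is multiplicative for the (`L`-bilinearly extended) cup products. -/
  iso_cup : ∀ ⦃n : ℕ⦄ ⦃X : SchemeOver k⦄, IsSmoothProjective n X →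
    ∀ ⦃i j m : ℕ⦄ (h : i + j = m) (x : L ⊗[K₁] W₁.obj X i) (y : L ⊗[K₁] W₁.obj X j),
      iso X m (W₁.cupBaseChange L h x y) = W₂.cupBaseChange L h (iso X i x) (iso X j y)
  /-- The comparison is compatible with the traces `H²ⁿ(X) → K`, `n = dim X`, extended to `L`:
  `tr₂ ∘ iso = tr₁` (Deligne–Milne 1982, I §1; for de Rham–Betti up to the Tate twist
  `(2πi)ⁿ`, absorbed in the choice of trace). -/
  iso_trace : ∀ ⦃n : ℕ⦄ ⦃X : SchemeOver k⦄, IsSmoothProjective n X →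
    ∀ x : L ⊗[K₁] W₁.obj X (2 * n),
      Module.Dual.baseChange L (W₂.trace X n) (iso X (2 * n) x) =
        Module.Dual.baseChange L (W₁.trace X n) x
  /-- The comparison matches cycle classes of prime cycles of codimension `p`:
  `iso (1 ⊗ cl₁(Z)) = 1 ⊗ cl₂(Z)` (Deligne–Milne 1982, I §1, compatibility with cycle maps). -/
  iso_cycleClass : ∀ ⦃n : ℕ⦄ ⦃X : SchemeOver k⦄, IsSmoothProjective n X →
    ∀ (p : ℕ) (z : X.left), Order.coheight z = p →
      iso X (2 * p) (1 ⊗ₜ W₁.cycleClass X p z) = 1 ⊗ₜ W₂.cycleClass X p z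

namespace WeilComparison

variable {k : Type u} [Field k] {K₁ : Type v} {K₂ : Type w} [Field K₁] [Field K₂]
  {W₁ : PreWeilCohomology k K₁} {W₂ : PreWeilCohomology k K₂} {L : Type w'} [Field L]
  [Algebra K₁ L] [Algebra K₂ L] (C : WeilComparison W₁ W₂ L)

/-- On a smooth projective `X`, the comparison map is an `L`-linear equivalence
`L ⊗_{K₁} H₁ⁱ(X) ≃ₗ[L] L ⊗_{K₂} H₂ⁱ(X)` (Deligne–Milne 1982, I §1). [cite: DeligneMilne1982, I §1] -/
def isoEquiv {n : ℕ} {X : SchemeOver k} (hX : IsSmoothProjective n X) (i : ℕ) :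
    L ⊗[K₁] W₁.obj X i ≃ₗ[L] L ⊗[K₂] W₂.obj X i :=
  LinearEquiv.ofLinear (C.iso X i) (C.isoInv X i) (LinearMap.ext (C.iso_isoInv hX i))
    (LinearMap.ext (C.isoInv_iso hX i))

/-- `isoEquiv` is `iso` as a function. [folklore] -/
@[simp]
lemma isoEquiv_apply {n : ℕ} {X : SchemeOver k} (hX : IsSmoothProjective n X) (i : ℕ)
    (x : L ⊗[K₁] W₁.obj X i) : C.isoEquiv hX i x = C.iso X i x := rfl

/-- The inverse of `isoEquiv` is `isoInv` as a function. [folklore] -/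
@[simp]
lemma isoEquiv_symm_apply {n : ℕ} {X : SchemeOver k} (hX : IsSmoothProjective n X) (i : ℕ)
    (y : L ⊗[K₂] W₂.obj X i) : (C.isoEquiv hX i).symm y = C.isoInv X i y := rfl

/-- On smooth projective `X` the comparison map is bijective. [folklore] -/
lemma bijective_iso {n : ℕ} {X : SchemeOver k} (hX : IsSmoothProjective n X) (i : ℕ) :
    Function.Bijective (C.iso X i) :=
  (C.isoEquiv hX i).bijective

/-- The **symmetric** comparison `W₂ ⇝ W₁`, obtained by exchanging `iso` and `isoInv`. [folklore] -/
def symm : WeilComparison W₂ W₁ L where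
  iso := C.isoInv
  isoInv := C.iso
  isoInv_iso _ _ hX := C.iso_isoInv hX
  iso_isoInv _ _ hX := C.isoInv_iso hX
  iso_pullback _ _ hX _ _ hY f i x := by
    conv_lhs => rw [← C.iso_isoInv hY i x, ← C.iso_pullback hX hY f i]
    rw [C.isoInv_iso hX]
  iso_one _ _ hX := by
    rw [← C.iso_one hX, C.isoInv_iso hX]
  iso_cup _ _ hX i j m h x y := by
    conv_lhs => rw [← C.iso_isoInv hX i x, ← C.iso_isoInv hX j y, ← C.iso_cup hX h]
    rw [C.isoInv_iso hX]
  iso_trace _ _ hX x := by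
    conv_rhs => rw [← C.iso_isoInv hX (2 * _) x]
    rw [C.iso_trace hX]
  iso_cycleClass _ _ hX p z hz := by
    rw [← C.iso_cycleClass hX p z hz, C.isoInv_iso hX]

/-- `symm` exchanges `iso` and `isoInv`. [folklore] -/
@[simp]
lemma symm_iso : C.symm.iso = C.isoInv := rfl

/-- `symm` exchanges `isoInv` and `iso`. [folklore] -/
@[simp]
lemma symm_isoInv : C.symm.isoInv = C.iso := rfl

/-- `symm` is an involution. [folklore] -/
@[simp]
lemma symm_symm : C.symm.symm = C := rfl

/-- The **period field** of `X` for the comparison `C`: the subfield of `L` generated by the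
periods `φ_L (iso (1 ⊗ v))`, `v ∈ H₁ⁱ(X)`, `φ ∈ H₂ⁱ(X)^∨`, of all degrees `i`. For the
de Rham–Betti comparison of a smooth projective `X/ℚ̄` this is the field generated by the
periods of `X` (Huber–Müller-Stach 2017, Ch. 11, §13.1; the subject of Grothendieck's period
conjecture, Deligne–Milne 1982, I §1, Remark 1.13). [cite: HuberMullerStach2017, Ch. 11  §13.1] -/
def periodField (X : SchemeOver k) : Subfield L :=
  Subfield.closure (⋃ i : ℕ, periodSet (C.iso X i))

/-- Periods of each degree lie in the period field of `X`. [folklore] -/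
lemma periodSet_subset_periodField (X : SchemeOver k) (i : ℕ) :
    periodSet (C.iso X i) ⊆ C.periodField X :=
  (Set.subset_iUnion (fun i : ℕ ↦ periodSet (C.iso X i)) i).trans Subfield.subset_closure

/-- The degree-`i` period field is contained in the period field of `X`. [folklore] -/
lemma periodField_iso_le (X : SchemeOver k) (i : ℕ) :
    Literature.AlgebraicGeometry.Motives.periodField (C.iso X i) ≤ C.periodField X :=
  Subfield.closure_mono (Set.subset_iUnion (fun i : ℕ ↦ periodSet (C.iso X i)) i)

/-! ### Comparison invariance -/

section Invariance

variable {K₁ : Type v} {K₂ : Type w} [Field K₁] [Field K₂] [CharZero K₁] [CharZero K₂]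
  {W₁ : WeilCohomology k K₁} {W₂ : WeilCohomology k K₂} {L : Type w'} [Field L]
  [Algebra K₁ L] [Algebra K₂ L] {n : ℕ} {X : SchemeOver k}

/-- Homological triviality of a codimension-`p` cycle is independent of the (compared) Weil
cohomology theory: `cl₁(c) = 0 ↔ cl₂(c) = 0`, since `iso (1 ⊗ cl₁(c)) = 1 ⊗ cl₂(c)` and
`x ↦ 1 ⊗ x` is injective over a field (Deligne–Milne 1982, I §1). [cite: DeligneMilne1982, I §1] -/
def isHomologicallyTrivial_iff : Prop :=
  ∀ (_ : WeilComparison W₁.toPreWeilCohomology W₂.toPreWeilCohomology L), IsSmoothProjective n X →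
    ∀ (p : ℕ) {c : AlgebraicCycle X.left ℤ}, c ∈ cyclesOfCodim X.left p →
      (W₁.IsHomologicallyTrivial X p c ↔ W₂.IsHomologicallyTrivial X p c)

end Invariance

end WeilComparison

end Literature.AlgebraicGeometry.Motives

end
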